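import Mathlib
import HarnessLib
import Summits.ValiantsHypothesis.ValiantsHypothesis.Theorems.LacunarySymmetroidMatrixDescartesOsculationLawRankOneSheets
import Summits.ValiantsHypothesis.ValiantsHypothesis.Theorems.LacunarySymmetroidMatrixDescartesOsculationLawRankOneInterlace

/-!
# ValiantsHypothesis / LacunarySymmetroid — crux `MatrixDescartes` (stmt-ValiantsHypothesis-18050, V1),
# line «osculation-law», rung O2 «DIAGONAL + RANK-ONE letters»: ENGINE part 1c — THE FIBRES OF THE CLASS ARE SIMPLE OFF THE CROSSINGS

Matrix-level corollary of parts 1 (`…RankOneSheets`, secular decomposition) and 1b (`…RankOneInterlace`, secular interlacing), at the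
full-rank splitting `(m, 0)`: for the pencil of the class «all letters diagonal except one letter `diagonal a₀ + vecMulVec w w'`»,

* `eval_insertionPoly_rankOne` — the fibre of the insertion polynomial over `t` IS the secular polynomial of the skeleton values
  `G_k(t) = Σ_{l≠l₀} t^(d l)·(S l)_kk + t^(d l₀)·a₀ k` with weights `w_k w'_k` and `M = t^(d l₀)`:
  `eval ![t, b] Φ = (secular polynomial at t).eval b`;
* `secular_reindex` — the secular polynomial is invariant under re-indexing the sheets (any bijection);
* ★ `card_fibre_roots_rankOne` — if `M = t^(d l₀) > 0`, the weights `w_k w'_k` are all positive and the skeleton values `G_k(t)` are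
  pairwise distinct, the fibre polynomial has exactly `m` distinct real roots (sort the skeleton by `Tuple.sort`, apply
  `card_roots_secular`): the `m` eigen-branches of the class over such `t` are SIMPLE — branch collisions happen only over skeleton crossings.

Honest framing: engine lemma for a restricted-class rung; no osculation count; `stub_osculationLaw` / `MatrixDescartes` / Conjecture B OPEN;
`VP ≠ VNP` NOT proved.  No definitions, no named facts.
-/

set_option linter.dupNamespace false

noncomputable section

namespace Summit.ValiantsHypothesis.ValiantsHypothesis.Theorems.LacunarySymmetroidMatrixDescartes

namespace OsculationSecular

open Polynomial
open scoped BigOperators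

/-- **The secular polynomial is invariant under re-indexing** the sheets by a bijection. [folklore] -/
theorem secular_reindex {ι κ : Type*} [Fintype ι] [DecidableEq ι] [Fintype κ] [DecidableEq κ] (e : ι ≃ κ)
    (g ω : κ → ℝ) (M : ℝ) :
    (∏ k, (X + C (g (e k))) + C M * ∑ k, C (ω (e k)) * ∏ k' ∈ Finset.univ.erase k, (X + C (g (e k')))) =
      ∏ k, (X + C (g k)) + C M * ∑ k, C (ω k) * ∏ k' ∈ Finset.univ.erase k, (X + C (g k')) := by
  congr 1
  · exact Fintype.prod_equiv e _ _ fun k => rfl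
  · congr 1
    refine Fintype.sum_equiv e _ _ fun k => ?_
    congr 1
    refine Finset.prod_equiv e (fun k' => ?_) (fun k' _ => rfl)
    simp only [Finset.mem_erase, Finset.mem_univ, and_true, ne_eq, EmbeddingLike.apply_eq_iff_eq]

/-- **The fibre of the class's insertion polynomial is the secular polynomial of the skeleton values** (splitting `(m,0)`). [folklore] -/
theorem eval_insertionPoly_rankOne (m K : ℕ) (d : Fin K → ℕ)
    (S : Fin K → Matrix (Fin m ⊕ Fin 0) (Fin m ⊕ Fin 0) ℝ) (l₀ : Fin K) (a₀ w w' : Fin m ⊕ Fin 0 → ℝ)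
    (hS : ∀ l, l ≠ l₀ → (S l).IsDiag) (h₀ : S l₀ = Matrix.diagonal a₀ + Matrix.vecMulVec w w') (t b : ℝ) :
    MvPolynomial.eval ![t, b]
        (∑ l, (MvPolynomial.X (0 : Fin 2) : MvPolynomial (Fin 2) ℝ) ^ d l •
              (S l).map (MvPolynomial.C : ℝ →+* MvPolynomial (Fin 2) ℝ)
            + (MvPolynomial.X (1 : Fin 2) : MvPolynomial (Fin 2) ℝ) •
              (Matrix.fromBlocks 1 0 0 0 : Matrix (Fin m ⊕ Fin 0) (Fin m ⊕ Fin 0) ℝ).map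
                (MvPolynomial.C : ℝ →+* MvPolynomial (Fin 2) ℝ)).det =
      (∏ k, (X + C ((∑ l ∈ Finset.univ.erase l₀, t ^ d l * S l k k) + t ^ d l₀ * a₀ k)) +
        C (t ^ d l₀) * ∑ k, C (w k * w' k) *
          ∏ k' ∈ Finset.univ.erase k, (X + C ((∑ l ∈ Finset.univ.erase l₀, t ^ d l * S l k' k') + t ^ d l₀ * a₀ k'))).eval b := by
  classical
  rw [insertionPoly_diagonal_add_rankOne m 0 K d S l₀ a₀ w w' hS h₀]
  have hV : ∀ k : Fin m ⊕ Fin 0, MvPolynomial.eval ![t, b]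
      ((∑ l ∈ Finset.univ.erase l₀, (MvPolynomial.X (0 : Fin 2) : MvPolynomial (Fin 2) ℝ) ^ d l * MvPolynomial.C (S l k k)) +
        (MvPolynomial.X (0 : Fin 2) : MvPolynomial (Fin 2) ℝ) ^ d l₀ * MvPolynomial.C (a₀ k) +
        MvPolynomial.X 1 * Sum.elim (fun _ => 1) (fun _ => 0) k) =
      b + ((∑ l ∈ Finset.univ.erase l₀, t ^ d l * S l k k) + t ^ d l₀ * a₀ k) := by
    intro k
    rcases k with i | j
    · simp only [map_add, map_sum, map_mul, map_pow, MvPolynomial.eval_X, MvPolynomial.eval_C, Sum.elim_inl, map_one,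
        Matrix.cons_val_zero, Matrix.cons_val_one]
      ring
    · exact j.elim0
  simp only [map_add, map_prod, map_mul, map_sum, map_pow, hV, MvPolynomial.eval_C, MvPolynomial.eval_X, Matrix.cons_val_zero,
    eval_add, eval_prod, eval_mul, eval_finsetSum, eval_C, eval_X, eval_pow]

/-- ★ **The fibres of the class are simple off the skeleton crossings**: if `M = t^(d l₀) > 0`, all weights `w_k w'_k > 0`, and the skeleton
values at `t` are pairwise distinct, the fibre polynomial has exactly `m` distinct real roots. [folklore] -/
theorem card_fibre_roots_rankOne (m : ℕ) (G ω : Fin m ⊕ Fin 0 → ℝ) (M : ℝ) (hM : 0 < M) (hω : ∀ k, 0 < ω k)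
    (hG : Function.Injective G) :
    (∏ k, (X + C (G k)) + C M * ∑ k, C (ω k) * ∏ k' ∈ Finset.univ.erase k, (X + C (G k'))).roots.toFinset.card = m := by
  classical
  -- re-index `Fin m ⊕ Fin 0 ≃ Fin m`, then sort the skeleton values
  let e₀ : Fin m ≃ Fin m ⊕ Fin 0 := (finSumFinEquiv (m := m) (n := 0)).symm
  let σ : Equiv.Perm (Fin m) := Tuple.sort (G ∘ e₀)
  let e : Fin m ≃ Fin m ⊕ Fin 0 := σ.trans e₀
  have hmono : Monotone (G ∘ e) := fun a b hab => Tuple.monotone_sort (G ∘ e₀) hab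
  have hinj : Function.Injective (G ∘ e) := hG.comp e.injective
  have hstrict : StrictMono (G ∘ e) := hmono.strictMono_of_injective hinj
  rw [← secular_reindex e G ω M]
  exact card_roots_secular (G ∘ e) hstrict (ω ∘ e) (fun k => hω (e k)) M hM

/-- The secular polynomial with all signs reflected: `p_{g,ω,M}(−X) = (−1)^n · p_{−g,ω,−M}(X)`. [folklore] -/
theorem secular_comp_neg_X {ι : Type*} [Fintype ι] [DecidableEq ι] (g ω : ι → ℝ) (M : ℝ) :
    (∏ k, (X + C (g k)) + C M * ∑ k, C (ω k) * ∏ k' ∈ Finset.univ.erase k, (X + C (g k'))).comp (-X) =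
      C ((-1) ^ Fintype.card ι) *
        (∏ k, (X + C (-g k)) + C (-M) * ∑ k, C (ω k) * ∏ k' ∈ Finset.univ.erase k, (X + C (-g k'))) := by
  classical
  have hlin : ∀ k, (X + C (g k)).comp (-X) = C (-1 : ℝ) * (X + C (-g k)) := by
    intro k; rw [add_comp, X_comp, C_comp, map_neg, map_neg, map_one]; ring
  have hprod : ∀ s : Finset ι, (∏ k ∈ s, (X + C (g k))).comp (-X) = C ((-1) ^ s.card) * ∏ k ∈ s, (X + C (-g k)) := by
    intro s
    rw [← Polynomial.coe_compRingHom_apply, map_prod]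
    simp only [Polynomial.coe_compRingHom_apply, hlin, Finset.prod_mul_distrib, Finset.prod_const, map_pow]
  rw [add_comp, mul_comp, C_comp, hprod, Finset.card_univ, ← Polynomial.coe_compRingHom_apply, map_sum]
  simp only [Polynomial.coe_compRingHom_apply, mul_comp, C_comp, hprod, Finset.card_erase_of_mem (Finset.mem_univ _), Finset.card_univ]
  rcases Nat.eq_zero_or_pos (Fintype.card ι) with h0 | hpos
  · haveI : IsEmpty ι := Fintype.card_eq_zero_iff.1 h0
    simp
  · have hpow : C ((-1 : ℝ) ^ Fintype.card ι) = -C ((-1 : ℝ) ^ (Fintype.card ι - 1)) := by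
      conv_lhs => rw [show Fintype.card ι = (Fintype.card ι - 1) + 1 from (Nat.sub_add_cancel hpos).symm, pow_succ]
      rw [map_mul, map_neg, map_one]; ring
    rw [hpow, mul_add, Finset.mul_sum, Finset.mul_sum, Finset.mul_sum, map_neg]
    congr 1; exact Finset.sum_congr rfl fun k _ => by ring

/-- ★ **NSD-coherent weights** (all `w_k w'_k < 0`, e.g. the letter `diagonal a₀ − w wᵀ`): again `m` distinct real roots (reflect `b ↦ −b`:
Mathlib `roots_comp_neg_X`, then the positive case for the reflected skeleton `−G`).  For a SYMMETRIC rank-one part `w w'ᵀ` one has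
`w' = λ·w`, so the weights `w_k w'_k = λ·w_k²` all carry the sign of `λ` (when no `w_k` vanishes): the two cases cover the class. [folklore] -/
theorem card_fibre_roots_rankOne_neg (m : ℕ) (G ω : Fin m ⊕ Fin 0 → ℝ) (M : ℝ) (hM : 0 < M) (hω : ∀ k, ω k < 0)
    (hG : Function.Injective G) :
    (∏ k, (X + C (G k)) + C M * ∑ k, C (ω k) * ∏ k' ∈ Finset.univ.erase k, (X + C (G k'))).roots.toFinset.card = m := by
  classical
  set p := ∏ k, (X + C (G k)) + C M * ∑ k, C (ω k) * ∏ k' ∈ Finset.univ.erase k, (X + C (G k')) with hp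
  -- the reflected polynomial is, up to the unit `(−1)^m`, the POSITIVE-weight secular polynomial of `−G` with weights `−ω`, `M`
  have hq : p.comp (-X) = C ((-1) ^ Fintype.card (Fin m ⊕ Fin 0)) *
      (∏ k, (X + C (-G k)) + C M * ∑ k, C (-ω k) * ∏ k' ∈ Finset.univ.erase k, (X + C (-G k'))) := by
    rw [hp, secular_comp_neg_X]
    congr 1
    simp only [map_neg, neg_mul, mul_neg, Finset.sum_neg_distrib]
  have hpos := card_fibre_roots_rankOne m (fun k => -G k) (fun k => -ω k) M hM (fun k => neg_pos.2 (hω k))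
    (fun a b h => hG (neg_injective h))
  -- roots of `p` ↔ roots of `p.comp (−X)` by negation
  have hunit : (C ((-1 : ℝ) ^ Fintype.card (Fin m ⊕ Fin 0))) ≠ 0 := by
    rw [Ne, Polynomial.C_eq_zero]; exact pow_ne_zero _ (by norm_num)
  have hcard : (p.comp (-X)).roots.toFinset.card = p.roots.toFinset.card := by
    rw [roots_comp_neg_X, Multiset.toFinset_map]
    exact Finset.card_image_of_injective _ neg_injective
  rw [← hcard, hq, Polynomial.roots_C_mul _ (pow_ne_zero _ (by norm_num))]
  exact hpos

end OsculationSecular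

end Summit.ValiantsHypothesis.ValiantsHypothesis.Theorems.LacunarySymmetroidMatrixDescartes

end
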